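import Literature.MathematicalPhysics.QuantumFieldTheory.Balaban1983to89.Setup

/-!
# SUBSTRATE — MÖBIUS (inclusion–exclusion) LOCALISATION, generic, and the restriction operation OF RECORD on gauge
# fields (items S-LOC ∕ S-RES of `substrate/SUBSTRATE-MAP.md`; typer sketch §L1–§L2)

Cell `pub-balaban`, SUBSTRATE cell, seat `b2b-balaban-substrate-p1`.  Summits-side under the LEAN PLACEMENT RULE (cell library; NOT a
Literature module).  HONEST FRAMING: rung (B)+1 of the FINITE-VOLUME T⁴ programme — NOT infinite volume, NOT a mass gap, NOT Clay;
spine PROVED 0∕9; this file is pure finite combinatorics (no estimate of any NE row, nothing of the audited papers asserted).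
HONEST DEPENDENCY (cell line, verbatim): continuum YM on T⁴ ⇐ BetaPertH ∧ nine spine estimates (0/9 proved); BetaPertH ⇐ (D1) ∧ (D4)
∧ CAP+tail; G-an2-4 gates asym, D1 and NE2/3/4.

WHAT.  Blocks `B` (a type with decidable equality; finite where sums over all blocks occur), configurations `Φ` with a RESTRICTION
`res : Finset B → Φ → Φ` («keep the variables in `Y`, set the others to the unit»).  The LOCALISED TERM of a function `A : Φ → ℝ` at
the block set `X` is the inclusion–exclusion transform `locTerm res A X φ := Σ_{Y ⊆ X} (−1)^{|X|−|Y|} A (res Y φ)` — the device by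
which [Balaban1987RG1] (0.22)–(0.25) pp. 256–257 writes an effective action as `Σ_X E(X, ·)` with `E(X, ·)` depending on the
configuration restricted to `X` (the SHAPE only is transcribed; Bałaban's own localisation goes through the cluster expansion of
[II] — this is the elementary Möbius version the substrate's «terms of record» use, item S-TERM).
* §1 `locTerm`, linearity in `A` (`locTerm_add`, `locTerm_finset_sum`), `ResLattice res` (restricting twice = restricting to the
  intersection; restricting to everything = identity);
* §2 MÖBIUS INVERSION `moebius_sum : Σ_{X ⊆ S} Σ_{Y ⊆ X} (−1)^{|X|−|Y|} f Y = f S` (via the interval sum `Σ_{Y ⊆ X ⊆ S} (−1)^{|X|−|Y|} =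
  [Y = S]`, `sum_interval_neg_one_pow`, from Mathlib's `Finset.sum_powerset_neg_one_pow_card`) and `locSum : Σ_{X ⊆ univ} locTerm res A X φ
  = A φ` (S-LOC-1);
* §3 LOCALITY `locTerm_local` (S-LOC-2: `locTerm res A X` reads `φ` only through `res X φ`), SUPPORT `locTerm_eq_zero_of_not_subset` ∕
  `locTerm_support` (S-LOC-3: a summand `E Y` reading only `Y ⊉ X` localises to `0` at `X` — the involution `Y' ↦ Y' ∆ {b}`, `b ∈ X ∖ Y`),
  and DECAY INHERITANCE `abs_locTerm_le` (S-LOC-4, explicit loss `2^{|X|}`);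
* §4 THE RESTRICTION OF RECORD on `Setup` gauge fields `resField blk Y U` (= `U` on bonds whose source block lies in `Y`, `1` elsewhere)
  and `resLattice_resField` (S-RES-1).
Imports `Setup` (hence Mathlib) only; nothing existing is modified.
-/

noncomputable section

open Finset
open scoped BigOperators

namespace Summit.QuantumFields.BalabanUV.T4Continuum.SubstrateLocalization

open Literature.MathematicalPhysics.QuantumFieldTheory.Balaban1983to89

/-! ## §1 The localised term and lattice-like restrictions -/

section Basic

variable {B Φ : Type*}

/-- [folklore] **MÖBIUS LOCALISATION** of `A : Φ → ℝ` at the block set `X`: `Σ_{Y ⊆ X} (−1)^{|X|−|Y|} A (res Y φ)` (the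
inclusion–exclusion transform along the restriction `res`). -/
def locTerm (res : Finset B → Φ → Φ) (A : Φ → ℝ) (X : Finset B) (φ : Φ) : ℝ :=
  ∑ Y ∈ X.powerset, (-1 : ℝ) ^ (X.card - Y.card) * A (res Y φ)

/-- [folklore] `locTerm` unfolded. -/
theorem locTerm_eq (res : Finset B → Φ → Φ) (A : Φ → ℝ) (X : Finset B) (φ : Φ) :
    locTerm res A X φ = ∑ Y ∈ X.powerset, (-1 : ℝ) ^ (X.card - Y.card) * A (res Y φ) := rfl

/-- [folklore] `locTerm` is additive in the function. -/
theorem locTerm_add (res : Finset B → Φ → Φ) (A A' : Φ → ℝ) (X : Finset B) (φ : Φ) :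
    locTerm res (fun ψ => A ψ + A' ψ) X φ = locTerm res A X φ + locTerm res A' X φ := by
  simp only [locTerm, mul_add, sum_add_distrib]

/-- [folklore] `locTerm` of a finite sum of functions is the sum of the `locTerm`s. -/
theorem locTerm_finset_sum {ι : Type*} (res : Finset B → Φ → Φ) (s : Finset ι) (E : ι → Φ → ℝ) (X : Finset B) (φ : Φ) :
    locTerm res (fun ψ => ∑ i ∈ s, E i ψ) X φ = ∑ i ∈ s, locTerm res (E i) X φ := by
  simp only [locTerm, mul_sum]
  rw [sum_comm]

/-- [folklore] At the empty block set the localised term is the value at the fully restricted configuration. -/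
theorem locTerm_empty (res : Finset B → Φ → Φ) (A : Φ → ℝ) (φ : Φ) : locTerm res A ∅ φ = A (res ∅ φ) := by
  simp [locTerm]

/-- [folklore] A restriction operation is LATTICE-LIKE: restricting twice is restricting to the intersection, and restricting to
all blocks is the identity (a hypothesis structure on the datum `res`; nothing is asserted for any particular restriction here —
the restriction of record satisfies it, `resLattice_resField`). -/
structure ResLattice [DecidableEq B] [Fintype B] (res : Finset B → Φ → Φ) : Prop where
  /-- `res X ∘ res Y = res (X ∩ Y)` -/
  inter : ∀ X Y φ, res X (res Y φ) = res (X ∩ Y) φ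
  /-- `res univ = id` -/
  univ : ∀ φ, res Finset.univ φ = φ

/-- [folklore] Lattice-like restrictions are idempotent. -/
theorem ResLattice.idem [DecidableEq B] [Fintype B] {res : Finset B → Φ → Φ} (h : ResLattice res) (X : Finset B) (φ : Φ) :
    res X (res X φ) = res X φ := by
  rw [h.inter, inter_self]

end Basic

/-! ## §2 Möbius inversion on the Boolean lattice -/

section Moebius

variable {B : Type*} [DecidableEq B]

/-- [folklore] `Σ_{W ⊆ D} (−1)^{|W|} = [D = ∅]` over `ℝ` (Mathlib's `Finset.sum_powerset_neg_one_pow_card`, cast). -/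
theorem sum_powerset_neg_one_pow_card_real (D : Finset B) :
    ∑ W ∈ D.powerset, (-1 : ℝ) ^ W.card = if D = ∅ then 1 else 0 := by
  have h := congrArg (fun z : ℤ => (z : ℝ)) (Finset.sum_powerset_neg_one_pow_card (x := D))
  simp only [Int.cast_sum, Int.cast_pow, Int.cast_neg, Int.cast_one] at h
  rw [h]
  split_ifs <;> simp

/-- [folklore] THE INTERVAL SUM: for `Y ⊆ S`, `Σ_{Y ⊆ X ⊆ S} (−1)^{|X|−|Y|} = [Y = S]` (substitute `W = X ∖ Y ⊆ S ∖ Y`). -/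
theorem sum_interval_neg_one_pow {Y S : Finset B} (hYS : Y ⊆ S) :
    ∑ X ∈ S.powerset.filter (fun X => Y ⊆ X), (-1 : ℝ) ^ (X.card - Y.card) = if Y = S then 1 else 0 := by
  have key : ∑ X ∈ S.powerset.filter (fun X => Y ⊆ X), (-1 : ℝ) ^ (X.card - Y.card)
      = ∑ W ∈ (S \ Y).powerset, (-1 : ℝ) ^ W.card := by
    refine Finset.sum_nbij' (fun X => X \ Y) (fun W => Y ∪ W) ?_ ?_ ?_ ?_ ?_
    · intro X hX
      simp only [mem_filter, mem_powerset] at hX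
      exact mem_powerset.2 (sdiff_subset_sdiff hX.1 le_rfl)
    · intro W hW
      rw [mem_powerset] at hW
      simp only [mem_filter, mem_powerset]
      exact ⟨union_subset hYS (hW.trans sdiff_subset), subset_union_left⟩
    · intro X hX
      simp only [mem_filter, mem_powerset] at hX
      exact union_sdiff_of_subset hX.2
    · intro W hW
      rw [mem_powerset] at hW
      rw [union_sdiff_left, Finset.sdiff_eq_self_iff_disjoint]
      exact sdiff_disjoint.mono_left hW
    · intro X hX
      simp only [mem_filter, mem_powerset] at hX
      rw [card_sdiff_of_subset hX.2]
  rw [key, sum_powerset_neg_one_pow_card_real]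
  by_cases h : Y = S
  · subst h
    simp
  · rw [if_neg h, if_neg]
    intro hS
    exact h (Subset.antisymm hYS (sdiff_eq_empty_iff_subset.1 hS))

/-- [folklore] **MÖBIUS INVERSION ON THE BOOLEAN LATTICE**: `Σ_{X ⊆ S} Σ_{Y ⊆ X} (−1)^{|X|−|Y|} f Y = f S`. -/
theorem moebius_sum (S : Finset B) (f : Finset B → ℝ) :
    ∑ X ∈ S.powerset, ∑ Y ∈ X.powerset, (-1 : ℝ) ^ (X.card - Y.card) * f Y = f S := by
  -- insert the indicator of `Y ⊆ X` and let `Y` range over `S.powerset`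
  have h1 : ∀ X ∈ S.powerset, ∑ Y ∈ X.powerset, (-1 : ℝ) ^ (X.card - Y.card) * f Y
      = ∑ Y ∈ S.powerset, if Y ⊆ X then (-1 : ℝ) ^ (X.card - Y.card) * f Y else 0 := by
    intro X hX
    have hXS := mem_powerset.1 hX
    rw [← sum_filter]
    refine sum_congr ?_ fun _ _ => rfl
    ext Y
    simp only [mem_powerset, mem_filter]
    exact ⟨fun h => ⟨h.trans hXS, h⟩, fun h => h.2⟩
  rw [sum_congr rfl h1, sum_comm]
  -- for each `Y`, the inner sum over `X` is the interval sum
  have h2 : ∀ Y ∈ S.powerset, (∑ X ∈ S.powerset, if Y ⊆ X then (-1 : ℝ) ^ (X.card - Y.card) * f Y else 0)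
      = (if Y = S then 1 else 0) * f Y := by
    intro Y hY
    rw [← sum_filter, ← sum_interval_neg_one_pow (mem_powerset.1 hY), sum_mul]
  rw [sum_congr rfl h2]
  simp

variable {Φ : Type*} [Fintype B]

/-- [folklore] **S-LOC-1 (MÖBIUS INVERSION)**: the localised terms over all block sets sum back to the function,
`Σ_{X ⊆ univ} locTerm res A X φ = A φ`. -/
theorem locSum {res : Finset B → Φ → Φ} (h : ResLattice res) (A : Φ → ℝ) (φ : Φ) :
    ∑ X ∈ (Finset.univ : Finset B).powerset, locTerm res A X φ = A φ := by
  simp only [locTerm]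
  rw [moebius_sum Finset.univ (fun Y => A (res Y φ)), h.univ]

end Moebius

/-! ## §3 Locality, support, decay inheritance -/

section Support

variable {B Φ : Type*} [DecidableEq B] [Fintype B] {res : Finset B → Φ → Φ}

/-- [folklore] **S-LOC-2 (LOCALITY)**: `locTerm res A X` depends on `φ` only through `res X φ`. -/
theorem locTerm_local (h : ResLattice res) (A : Φ → ℝ) (X : Finset B) (φ : Φ) :
    locTerm res A X φ = locTerm res A X (res X φ) := by
  refine sum_congr rfl fun Y hY => ?_
  rw [h.inter, inter_eq_left.2 (mem_powerset.1 hY)]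

/-- [folklore] A function READING ONLY `Y` (`E ψ = E (res Y ψ)`) takes the same value at `res Y' φ` and at `res (Y ∩ Y') φ`. -/
theorem apply_res_eq_of_reads (h : ResLattice res) {E : Φ → ℝ} {Y : Finset B} (hE : ∀ ψ, E ψ = E (res Y ψ)) (Y' : Finset B)
    (φ : Φ) : E (res Y' φ) = E (res (Y ∩ Y') φ) := by
  rw [hE (res Y' φ), h.inter, hE (res (Y ∩ Y') φ), h.inter, ← inter_assoc, inter_self]

/-- [folklore] **THE SUPPORT PROPERTY**: a function reading only `Y` localises to ZERO at every `X ⊄ Y` (involution `Y' ↦ Y' ∆ {b}` on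
`X.powerset` for some `b ∈ X ∖ Y`: the values agree, the signs are opposite). -/
theorem locTerm_eq_zero_of_not_subset (h : ResLattice res) {E : Φ → ℝ} {Y : Finset B} (hE : ∀ ψ, E ψ = E (res Y ψ))
    {X : Finset B} (hXY : ¬ X ⊆ Y) (φ : Φ) : locTerm res E X φ = 0 := by
  obtain ⟨b, hbX, hbY⟩ := not_subset.1 hXY
  -- the value of `E (res Y' φ)` is blind to `b`
  have hval : ∀ Y' : Finset B, E (res (insert b Y') φ) = E (res Y' φ) := by
    intro Y'
    rw [apply_res_eq_of_reads h hE, apply_res_eq_of_reads h hE Y', inter_insert_of_notMem hbY]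
  refine sum_involution (fun Y' _ => if b ∈ Y' then Y'.erase b else insert b Y') ?_ ?_ ?_ ?_
  · -- the two terms cancel
    intro Y' hY'
    have hY'X := mem_powerset.1 hY'
    by_cases hb : b ∈ Y'
    · simp only [if_pos hb]
      have hcard : (Y'.erase b).card + 1 = Y'.card := card_erase_add_one hb
      have hle : Y'.card ≤ X.card := card_le_card hY'X
      have hexp : X.card - (Y'.erase b).card = (X.card - Y'.card) + 1 := by omega
      rw [hexp, pow_succ, ← insert_erase hb, hval, erase_insert (notMem_erase b Y')]
      ring
    · simp only [if_neg hb]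
      have hcard : (insert b Y').card = Y'.card + 1 := card_insert_of_notMem hb
      have hle : (insert b Y').card ≤ X.card := card_le_card (insert_subset hbX hY'X)
      have hexp : X.card - Y'.card = (X.card - (insert b Y').card) + 1 := by omega
      rw [hexp, pow_succ, hval]
      ring
  · -- the involution has no fixed points
    intro Y' _ _
    by_cases hb : b ∈ Y'
    · simp only [if_pos hb]
      exact fun heq => (notMem_erase b Y') (heq.symm ▸ hb)
    · simp only [if_neg hb]
      exact fun heq => hb (heq ▸ mem_insert_self b Y')
  · -- it stays inside `X.powerset`
    intro Y' hY'
    have hY'X := mem_powerset.1 hY'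
    by_cases hb : b ∈ Y'
    · simp only [if_pos hb]
      exact mem_powerset.2 ((erase_subset b Y').trans hY'X)
    · simp only [if_neg hb]
      exact mem_powerset.2 (insert_subset hbX hY'X)
  · -- and is an involution
    intro Y' _
    by_cases hb : b ∈ Y'
    · simp only [if_pos hb, notMem_erase, if_false, insert_erase hb]
    · simp only [if_neg hb, mem_insert_self, if_true, erase_insert hb]

/-- [folklore] **S-LOC-3 (SUPPORT)**: if `A = Σ_{Y ⊆ univ} E Y` with each `E Y` reading only `Y`, then `locTerm A X` sees only the
summands with `Y ⊇ X`: `locTerm A X φ = Σ_{Y ⊇ X} locTerm (E Y) X φ`. -/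
theorem locTerm_support (h : ResLattice res) (E : Finset B → Φ → ℝ) (hE : ∀ Y ψ, E Y ψ = E Y (res Y ψ)) (X : Finset B) (φ : Φ) :
    locTerm res (fun ψ => ∑ Y ∈ (Finset.univ : Finset B).powerset, E Y ψ) X φ
      = ∑ Y ∈ (Finset.univ : Finset B).powerset.filter (fun Y => X ⊆ Y), locTerm res (E Y) X φ := by
  rw [locTerm_finset_sum, sum_filter]
  refine sum_congr rfl fun Y _ => ?_
  split_ifs with hXY
  · rfl
  · exact locTerm_eq_zero_of_not_subset h (hE Y) hXY φ

omit [DecidableEq B] [Fintype B] in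
/-- [folklore] Crude size of a localised term: `|locTerm res E X φ| ≤ 2^{|X|} · sup |E|`. -/
theorem abs_locTerm_le_pow (E : Φ → ℝ) {M : ℝ} (hM : ∀ ψ, |E ψ| ≤ M) (X : Finset B) (φ : Φ) :
    |locTerm res E X φ| ≤ 2 ^ X.card * M := by
  calc |locTerm res E X φ| ≤ ∑ Y ∈ X.powerset, |(-1 : ℝ) ^ (X.card - Y.card) * E (res Y φ)| := abs_sum_le_sum_abs _ _
    _ ≤ ∑ _Y ∈ X.powerset, M := sum_le_sum fun Y _ => by
        rw [abs_mul, abs_pow, abs_neg, abs_one, one_pow, one_mul]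
        exact hM _
    _ = 2 ^ X.card * M := by rw [sum_const, card_powerset, nsmul_eq_mul, Nat.cast_pow, Nat.cast_ofNat]

/-- [folklore] **S-LOC-4 (DECAY INHERITANCE, explicit loss `2^{|X|}`)**: if `A = Σ_Y E Y` with `E Y` reading only `Y` and
`|E Y ψ| ≤ E₀·e^{−κ ℓ(Y)}` for all `ψ`, then `|locTerm A X φ| ≤ E₀ · 2^{|X|} · Σ_{Y ⊇ X} e^{−κ ℓ(Y)}`. -/
theorem abs_locTerm_le (h : ResLattice res) (E : Finset B → Φ → ℝ) (hE : ∀ Y ψ, E Y ψ = E Y (res Y ψ)) (ℓ : Finset B → ℝ)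
    (E₀ κ : ℝ) (hbd : ∀ Y ψ, |E Y ψ| ≤ E₀ * Real.exp (-(κ * ℓ Y))) (X : Finset B) (φ : Φ) :
    |locTerm res (fun ψ => ∑ Y ∈ (Finset.univ : Finset B).powerset, E Y ψ) X φ|
      ≤ E₀ * 2 ^ X.card * ∑ Y ∈ (Finset.univ : Finset B).powerset.filter (fun Y => X ⊆ Y), Real.exp (-(κ * ℓ Y)) := by
  rw [locTerm_support h E hE, mul_sum]
  refine (abs_sum_le_sum_abs _ _).trans (sum_le_sum fun Y _ => ?_)
  calc |locTerm res (E Y) X φ| ≤ 2 ^ X.card * (E₀ * Real.exp (-(κ * ℓ Y))) := abs_locTerm_le_pow (E Y) (hbd Y) X φ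
    _ = E₀ * 2 ^ X.card * Real.exp (-(κ * ℓ Y)) := by ring

/-- [folklore] The localised term of a function reading only `Y` itself reads only `Y` (indeed only `X ∩ Y`). -/
theorem locTerm_reads (h : ResLattice res) {E : Φ → ℝ} {Y : Finset B} (hE : ∀ ψ, E ψ = E (res Y ψ)) (X : Finset B) (φ : Φ) :
    locTerm res E X φ = locTerm res E X (res Y φ) := by
  refine sum_congr rfl fun Y' _ => ?_
  rw [h.inter, apply_res_eq_of_reads h hE Y', apply_res_eq_of_reads h hE (Y' ∩ Y), ← inter_assoc, inter_comm Y Y',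
    inter_assoc, inter_self]

end Support

/-! ## §4 The restriction of record on `Setup` gauge fields -/

section Restrict

variable {P : Params} {j : ℕ} {G : Type*} [GaugeGroup G] {B : Type*} [DecidableEq B]

/-- [folklore] **THE RESTRICTION OF RECORD**: keep the bond variables whose SOURCE lies in a block of `Y` (block map `blk`), set the
others to `1` — the reading of «`U` restricted to `X`» of [Balaban1987RG1] (0.24) p. 257 on the carriers of record (shape only). -/
def resField (blk : Site P j → B) (Y : Finset B) (U : GaugeField P j G) : GaugeField P j G :=
  fun b => if blk b.src ∈ Y then U b else 1

/-- [folklore] `resField` unfolded. -/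
theorem resField_apply (blk : Site P j → B) (Y : Finset B) (U : GaugeField P j G) (b : PBond P j) :
    resField blk Y U b = if blk b.src ∈ Y then U b else 1 := rfl

/-- [folklore] On bonds sourced in `Y` the restriction keeps the variable. -/
theorem resField_apply_of_mem (blk : Site P j → B) {Y : Finset B} (U : GaugeField P j G) {b : PBond P j} (hb : blk b.src ∈ Y) :
    resField blk Y U b = U b := by
  rw [resField_apply, if_pos hb]

/-- [folklore] Off `Y` the restriction is the unit. -/
theorem resField_apply_of_not_mem (blk : Site P j → B) {Y : Finset B} (U : GaugeField P j G) {b : PBond P j}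
    (hb : blk b.src ∉ Y) : resField blk Y U b = 1 := by
  rw [resField_apply, if_neg hb]

/-- [folklore] Restricting the trivial configuration gives the trivial configuration. -/
@[simp] theorem resField_one (blk : Site P j → B) (Y : Finset B) : resField blk Y (1 : GaugeField P j G) = 1 := by
  funext b
  unfold resField
  split_ifs <;> rfl

/-- [folklore] Restricting to no block gives the trivial configuration. -/
@[simp] theorem resField_empty (blk : Site P j → B) (U : GaugeField P j G) : resField blk ∅ U = 1 := by
  funext b
  simp [resField]
  rfl

/-- [folklore] **S-RES-1**: the restriction of record is lattice-like (`ResLattice`). -/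
theorem resLattice_resField [Fintype B] (blk : Site P j → B) : ResLattice (resField (G := G) blk) where
  inter X Y U := by
    funext b
    simp only [resField_apply, mem_inter]
    by_cases hX : blk b.src ∈ X <;> by_cases hY : blk b.src ∈ Y <;> simp [hX, hY]
  univ U := by
    funext b
    simp [resField_apply]

end Restrict

end Summit.QuantumFields.BalabanUV.T4Continuum.SubstrateLocalization

end
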